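import Literature.MathematicalPhysics.QuantumFieldTheory.Balaban1983to89.B6Eq292MemberTorusV1L0
import Literature.MathematicalPhysics.QuantumFieldTheory.Balaban1983to89.B6Partition118KLevelTorusBindersL0
import Literature.MathematicalPhysics.QuantumFieldTheory.Balaban1983to89.B6ScalarChartV1L0
import Literature.MathematicalPhysics.QuantumFieldTheory.Balaban1983to89.B8Ineq192MultiLevelTorusL0
import Literature.MathematicalPhysics.QuantumFieldTheory.Balaban1983to89.B6CubeCoeffSizesV1
/-!
# `Balaban1983to89.B6CubeCoeffSizesV1L0` — LEVEL-0 TWIN (programme G-F3′-L0, director-ym LINE №27 / UV3-NODE §24.5; plan `lit-balaban-r03/G-F3L0-PLAN.md`) of `B6CubeCoeffSizesV1`: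
the same declarations, SAME NAMES AND STATEMENTS, for nested families WITH print's region `Λ₀ = T ∖ Ω₁` ADMITTED (structures
`B6MultiLevelBoxOperatorL0.Domains` / `B6MultiLevelTorusOperatorL0.TDomains`: levels `0, …, k`, the level-`0` block a single site, `Q′₀ = id`,
finite weight `a₀` — print p.225 (2.14) «Σ_{j=0}^k … (Q′₀λ)(x) = λ(x), x ∈ Λ₀», p.229 «taking a sequence (2.1) … smallest possible domains B^j(Λ_j),
and considering the operator Δ_a defined by (2.19), (2.20) for this sequence»).  Every `D`-free object is the lineage's, consumed BY NAME; no existing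
module is touched; no fact is minted.  Unit `lit-balaban-p33` (p33 gen 89; S-E entry twins named to p33 by the B6 owner r03 gen 36, ruling 2026-08-27T18:45:57Z; port tooling by r03 gen 36); B6 fold owner r03; referee ref-4.  LEVEL-0 JOINT J2 ENTERS THE V1 LAYER IN THIS FILE (B6 owner r03 gen 36, PLAN v1.1 §9 (4): the fine-step size `B6Partition118KLevelTorusBindersL0.abs_hT_sub_le_near` carries `hMh : 2·(ℓ+1) ≤ Mh`): `abs_hch_shift_sub_le` / `abs_hch_unshift_sub_le` take `(hMhL : 2 * (ℓ + 1) ≤ Mh)` IN PLACE of the twin's `(hM8 : 8 ≤ Mh)` (whose only use there was `2 ≤ Mh`), and `abs_cfC_chart_le` / `abs_cfC_le` take the ADDITIONAL binder `(hMhL : 2 * (ℓ + 1) ≤ Mh)` immediately after `(hM8 : 8 ≤ Mh)`; every other statement is the twin's verbatim; downstream twins pass `hMhL` positionally.  THE TWIN'S DOCUMENTATION FOLLOWS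
VERBATIM (its «levels 1 … k» / «Ω₁ = X» sentences describe the twin; here `j` runs from `0` and `Ω₁` may be a proper subset).

# `Balaban1983to89.B6CubeCoeffSizesV1` — T. Bałaban, *Propagators and renormalization transformations for lattice gauge theories. II*,
# Commun. Math. Phys. **96** (1984) 223–250 [Balaban1984PropagatorsII], p. 247 / (2.92) p. 239 line 1: THE SIZES AND SUPPORTS OF THE COEFFICIENTS
# `c_e = s(□)·(E_eh_□)`, `c₀ = s(□)·(Δh_□)` OF THE GENUINE MEMBER OF A CUBE ON THE GLOBAL TORUS — *"|∂h_□| ≤ O(1)(ML^jη)^{−1}, |Δh_□| ≤ O(1)M^{−1}(L^jη)^{−2}"*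
# read through the window chart: the binders `hcf`, `hcfT`, `hc₀`, `hc₀T` of `…B6Ineq2134KFamKLevelTorusInL0.h2134_kFam_torus_in` for p38's `cfC`, `c0C`

statement-level skeleton of published theorems with citation tags; proofs where landed; nothing here is a claim about the Yang–Mills mass gap

PDF held: `paper:balaban1984-cmp96-propagators-rt-ii` (journal page = PDF page + 222): p. 239 [PDF 17] (2.92), p. 247 [PDF 25]; read from the tree
transcriptions (`…B6Ineq2134Diag`, `…B6Partition118KLevelFineSecond`, `…B6Eq292MemberTorusV1`).  PRINT p. 247: *"|∂h_□| ≤ O(1)(ML^jη)^{−1},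
|Δh_□| ≤ O(1)M^{−1}(L^jη)^{−2}"*; the supports of these functions lie in □̃ — OUR PARAPHRASE of p. 239 (ζ_□ *"equal to 1 on a cube containing □ … equal to 0
outside a similar cube"*) and (2.36) p. 229, NOT a printed sentence (v1/v1.1 had this clause inside the quotation marks attributed to p. 247; v1.2 DOCFIX per
ref-4 D-g67-1; Lean content unchanged).

CITATION HEADER (lean-in-tree rule) — WHAT IS REPRODUCED.  Phase-2 file of the `lit-balaban` typed skeleton, seat **p38 gen 27**; owner r03 gen 21's division
(seat INBOX 2026-08-23T06:11Z/07:03Z: *"remaining per-cube inputs: p38's (a) coefficient sizes hcf/hc₀ (+hcfT/hc₀T)"*).  SKELETON rows **B6.Eq2.92** ×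
**B6.Eq2.134** (cells only).  The coefficients of `…B6Eq292MemberTorusV1L0.hdec_cube` are `cfC e = τ_{−v}ε(s(□)•E_e(ρh^ch_□))`, `c0C = τ_{−v}ε(s(□)•Δ_□(ρh^ch_□))`
(`ε/ρ` = extension/restriction through the bijective bond window `cB`, `τ` = the chart translation, `s(□) = (c′/L^{j₀})²`, `E_e = L^{j₀}(S_{±λ} − 1)`,
`Δ_□ = Σ_λ∇_λ*∇_λ`).  THIS FILE (v1 = the geometric half): §1 torus neighbours (`|σ_{±e_μ}z − z|_T ≤ 1`) and **`blkOf_mem_QT_of_near_hT`** — the blocks ADJACENT to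
`supp h^T_□` are blocks of `□⁺ = QT □` (`M_h ≥ 8`: block side `≤ L^{j+1} ≤ S/8`); §2 the chart-frame `h^ch_□ = h^T_□ ∘ σ_□ ∘ toBox` (`hch_eq_hT`), its
nearest-neighbour sizes **`abs_hch_shift_sub_le`/`abs_hch_unshift_sub_le`** (`C1F/(8S/5)`) and **`abs_hch_second_le`** (`C2F/(8S/5)²`) from
`…TorusBinders.abs_hT_sub_le_near/abs_hT_second_diff_le`, the reach membership **`blkOf_σch_mem_QT`** of the blocks at and next to the support, and
`blkV1_translate_vch`.  **v1.1 (p38 gen 28, APPEND-ONLY)**: §3 the window-side values of `ρh` ARE honest values of `h` one lattice step around a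
window site for `h` supported on the bonds of margin `1` (`restrictB_apply'`, `restrictB_shift_apply'`, `restrictB_unshift_apply'` — the member torus
does not wrap next to `supp h`; p22's `B6GluedLegsWindow.restrictB_unshift_apply` pattern for every direction), whence the transplanted coefficients are
honest differences: `extend_smul_Dl_apply`/`extend_smul_Dla_apply` (`ε(κ•∇^{(*)}_μ(ρh))(b) = κL^j(h(b ± e_μ) − h(b))`), `extend_smul_lapTS_apply`; §4 THE
BINDERS OF `h2134_kFam_torus_in` FOR THE CUBE: **`cfC_supp`**/**`c0C_supp`** (`c_e(x) ≠ 0`, `c₀(x) ≠ 0 ⟹ blkV1 x ∈ ST □`) and **`abs_cfC_le`**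
(`|c_e(x)| ≤ s₁c′²/(M·len(y(x))²)`, `s₁ := C1F·L³`), **`abs_c0C_le`** (`|c₀(x)| ≤ s₂c′²/(M·len(y(x))²)`, `s₂ := (d+1)·C2F·L`) — the shapes displayed as
hypotheses (iii) of r03's `B6Prop26KLevelAssemblyV1.prop26_2136_kLevel_assembly` (p358050); `s1C_nonneg`, `s2C_nonneg`.
THEOREMS ONLY; standard axioms.

HONEST SCOPE / DIVERGENCES. (i) Lattice units, `η = 1`.  (ii) `M_h = L^a ≥ 8`, `P′_μ ≥ 5`, `R ≥ 2L²`, placed cube, as in the cube files.  (iii) Bookkeeping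
only: no estimate of [6] beyond (1.118)'s sizes is involved; the constants `s₁ = C1F·L³`, `s₂ = (d+1)·C2F·L` depend on `d, L` only (print: «O(1)»), and in
`s₂` the spare factor `(L·M_h)^{−1}` of print's `M^{−1}(L^jη)^{−2}` versus the binder's `M^{−1}len^{−2}` is given away.  Nothing on d = 4 or the continuum;
NOT summit progress.  Unit `lit-balaban-p38` (gen 27: v1; gen 28: v1.1), 2026-08-23.
-/

noncomputable section

open scoped BigOperators
open Finset

namespace Literature.MathematicalPhysics.QuantumFieldTheory.Balaban1983to89.B6CubeCoeffSizesV1L0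

open LatticeFieldCalculus
open B4ContourShift (supNorm abs_le_supNorm)
open B4Reflection242 (boxDom)
open B4TorusKernel.MultiPeriod (torusSupNorm torusSupNorm_translate torusSupNorm_le_supNorm translate)
open B6MultiLevelBoxOperator (N0 bigSide)
open B6MultiLevelTorusOperator (tshift tshift_val_eq_translate tshift_tshift unitVec one_le_of_mem)
open B6MultiLevelTorusOperatorL0 (TDomains)
open B6Geom246MultiLevelBox (toR)
open B6Geom246MultiLevelBoxL0 (bset blkOf)
open B6Geom246MultiLevelTorus (torusSupNorm_neg)
open B6Cover236MultiLevelBlocksL0 (cubes side ctr Q mem_Q)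
open B6Eq238MultiLevelTorus (svec)
open B6Partition118KLevelFineL0 (hF dist_lt_of_hF_ne_zero lev_window_of_dist_lt_three_halves)
open B6Partition118KLevelFineSizes (C1F C1F_nonneg)
open B6Partition118KLevelFineSecond (C2F C2F_nonneg)
open B6Partition118KLevelTorusL0 (hT)
open B6Partition118KLevelTorusCentralL0 (Dch σch cc QT side_cc hT_eq_hF_cc lev_blkOf_σch blkOf_mem_QT_of_hT_ne_zero)
open B6Partition118KLevelTorusBinders (dist_le_one_of_torus)
open B6Partition118KLevelTorusBindersL0 (abs_hT_sub_le_near abs_hT_second_diff_le torusSupNorm_σch_symm siteDeep_three_of_hF_ne_zero)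
open B6TorusDepthDistanceL0 (blkOf_eq_blkMap_symm)
open B6Geom246MultiLevelBoxL0 (dist_toR_cen_le cen)
open Literature.MathematicalPhysics.QuantumFieldTheory.Balaban1983to89.B6CubeCoeffSizesV1 (torusSupNorm_tshift_single_le torusSupNorm_tshift_unitVec_le torusSupNorm_tshift_neg_unitVec_le one_le_ell restrictB_apply' restrictB_shift_apply' restrictB_unshift_apply' extend_smul_Dl_apply extend_smul_Dla_apply extend_smul_lapTS_apply extend_apply_of_not_mem s1C_nonneg s2C_nonneg)

variable {d ℓ : ℕ}

/-! ## §1  Torus neighbours; the blocks adjacent to `supp h_□` lie in `□⁺` -/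

section Near

variable {Mh k R : ℕ} {P : Fin (d + 1) → ℕ}

variable (D : TDomains d ℓ Mh k P R)

/-- **THE BLOCKS ADJACENT TO `supp h^T_□` LIE IN `□⁺`** (`M_h ≥ 8`): `h^T_□(z′) ≠ 0`, `|z − z′|_T ≤ 1 ⟹ y(z) ∈ QT □` — the coefficients `E_eh_□`,
`Δh_□` live one lattice step around `supp h_□`; their blocks are still blocks of the reach (block side `≤ L^{j+1} ≤ S/8`).
[cite: Balaban1984PropagatorsII, p.239/p.247 (supports of h_□, ζ_□ in □̃ — our paraphrase of p.239 «equal to 1 on a cube containing □ … equal to 0 outside a similar cube», not a printed sentence), p.235, bookkeeping] -/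
theorem blkOf_mem_QT_of_near_hT (hℓ : 1 ≤ ℓ) (hM8 : 8 ≤ Mh) (hR : 2 * (ℓ + 1) ≤ R) (hP5 : ∀ μ, 5 ≤ P μ) {hMh1 : 1 ≤ Mh} (hP4 : ∀ μ, 4 ≤ P μ)
    (c : ↥(B6Cover236MultiLevelBlocksL0.cubes D.toDomains)) {z z' : ↥(boxDom (N0 ℓ Mh k P))} (h : hT D c z' ≠ 0) (hzz' : torusSupNorm (N0 ℓ Mh k P) (z.1 - z'.1) ≤ 1) :
    blkOf D.toDomains z ∈ QT D hMh1 hP4 c := by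
  have hMh : 2 ≤ Mh := le_trans (by norm_num) hM8
  rw [hT_eq_hF_cc hMh1 hP4 c z'] at h
  -- in the canonical chart: `x = σ_c⁻¹ z` is a lattice neighbour of `x′ = σ_c⁻¹ z′ ∈ supp h^F`
  have hT1 : torusSupNorm (N0 ℓ Mh k P) (((σch D c).symm z').1 - ((σch D c).symm z).1) ≤ 1 := by
    rw [torusSupNorm_σch_symm, show z'.1 - z.1 = -(z.1 - z'.1) by abel, torusSupNorm_neg (one_le_of_mem z.2)]; exact hzz'
  have hnear := dist_le_one_of_torus ((siteDeep_three_of_hF_ne_zero hℓ hMh hR hP5 c h).mono (by norm_num)) hT1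
  have hx'c := dist_lt_of_hF_ne_zero (Dch D c) hMh1 h
  set x := (σch D c).symm z with hx
  set x' := (σch D c).symm z' with hx'
  have hnear' : dist (toR x.1) (toR x'.1) ≤ 1 := by rw [dist_comm]; exact hnear
  have hp1 : (1 : ℝ) ≤ (((ℓ + 1) ^ (c.1.1 + 1) : ℕ) : ℝ) := by exact_mod_cast Nat.one_le_pow _ _ (by omega)
  have hS : side (Dch D c) (cc D hMh1 hP4 c) = (bigSide ℓ Mh c.1.1 : ℝ) := side_cc hMh1 hP4 c
  have h8 : 8 * (((ℓ + 1) ^ (c.1.1 + 1) : ℕ) : ℝ) ≤ side (Dch D c) (cc D hMh1 hP4 c) := by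
    rw [hS]; unfold bigSide; push_cast
    have : (8 : ℝ) ≤ Mh := by exact_mod_cast hM8
    have hp : (0 : ℝ) ≤ ((ℓ : ℝ) + 1) ^ (c.1.1 + 1) := by positivity
    nlinarith
  have h32 : dist (toR x.1) (ctr (Dch D c) (cc D hMh1 hP4 c)) < 3 / 2 * side (Dch D c) (cc D hMh1 hP4 c) := by
    linarith [dist_triangle (toR x.1) (toR x'.1) (ctr (Dch D c) (cc D hMh1 hP4 c))]
  have hlev := (lev_window_of_dist_lt_three_halves (Dch D c) hMh1 hR h32).2
  -- the block of `x` in the chart frame is in `Q`: its centre is within `(L^{j+1} − 1)/2 + 1 + S ≤ 5S/4` of the centre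
  have hcen := dist_toR_cen_le (Dch D c) (rfl : blkOf (Dch D c) x = blkOf (Dch D c) x)
  have hL1 : 1 ≤ ℓ + 1 := by omega
  have hpow : (((ℓ + 1) ^ (blkOf (Dch D c) x).1.1 : ℕ) : ℝ) ≤ (((ℓ + 1) ^ (c.1.1 + 1) : ℕ) : ℝ) := by
    exact_mod_cast Nat.pow_le_pow_right hL1 hlev
  have hQ : blkOf (Dch D c) x ∈ Q (Dch D c) (cc D hMh1 hP4 c) := by
    refine (mem_Q (Dch D c)).2 ?_
    calc dist (cen (Dch D c) (blkOf (Dch D c) x)) (ctr (Dch D c) (cc D hMh1 hP4 c))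
        ≤ dist (toR x.1) (cen (Dch D c) (blkOf (Dch D c) x)) + dist (toR x.1) (ctr (Dch D c) (cc D hMh1 hP4 c)) :=
          dist_triangle_left _ _ _
      _ ≤ dist (toR x.1) (cen (Dch D c) (blkOf (Dch D c) x)) + (dist (toR x.1) (toR x'.1) +
            dist (toR x'.1) (ctr (Dch D c) (cc D hMh1 hP4 c))) := by linarith [dist_triangle (toR x.1) (toR x'.1) (ctr (Dch D c) (cc D hMh1 hP4 c))]
      _ ≤ 5 / 4 * side (Dch D c) (cc D hMh1 hP4 c) := by nlinarith
  -- back to the torus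
  unfold QT
  rw [blkOf_eq_blkMap_symm (D := D) hMh1 (fun μ => le_trans (by norm_num) (hP4 μ)) (svec ℓ k c.1.1 c.1.2) z]
  exact Finset.mem_image_of_mem _ hQ

end Near

/-! ## §2  The chart-frame `h_□`: nearest-neighbour sizes and the blocks around its support -/

section Chart

open B6Ineq2133TwoScaleV1 (onFun onFun_apply)
open B6GlobalChartV1 (PV toBox)
open B6GlobalChartV1L0 (domT blkV1)
open B6SectAOperatorsV1 (BondIdx)
open B6Prop25TwoScaleCensus (TSIdx)
open B6AgreeLapV1Chart (cB eB eS DeepS mem_cB_W eS_shift eS_unshift eS_injOn deepS_mono shift_mem_deepS unshift_mem_deepS)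
open B6TranslateV1 (trV trV_apply)
open B6TranslateTorusV1 (vch toBox_add_tv)
open B6ScalarChartV1 (toBox_shift toBox_unshift)
open B6Prop26KLevelSkeletonV1L0 (hB ST)
open B6CubeWindowV1 (x0 Placed)
open B6CubeWindowV1L0 (tC tC_j sc hx0 hfit wC hch hch_apply hch_deep j0 j0_le_level)
open B6Eq292MemberTorusV1L0 (cfC c0C)
open B10StarCount (shift_unshift unshift_shift)

variable {hd : 1 ≤ d + 1} {hL : Odd (ℓ + 1) ∧ 1 < ℓ + 1} {a₀ a₁ : ℝ} {m K : ℕ} {Mh k R : ℕ} {P' : Fin (d + 1) → ℕ}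
variable (hN : ∀ μ, N0 ℓ Mh k P' μ = (PV d ℓ m K hd hL).sitesPerDir 0) {D : TDomains d ℓ Mh k P' R} (hk : k ≤ m + K)
  (hMh1 : 1 ≤ Mh) (hP4 : ∀ μ, 4 ≤ P' μ) {a : ℕ} (hMha : Mh = (ℓ + 1) ^ a) (c : ↥(cubes D.toDomains)) (ha : a₀ ≤ a₁)

/-- `h^ch_□(b) = h^T_□(σ_□(toBox b₋))`: the chart-frame `h_□` is the torus `h_□` at the translated site. [cite: Balaban1984PropagatorsII, (2.36) p.229, dictionary (charts)] -/
theorem hch_eq_hT (b : PBond (PV d ℓ m K hd hL) 0) : B6CubeWindowV1L0.hch hN hMh1 hP4 c b = hT D c (σch D c (toBox hN b.src)) := by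
  rw [hch_apply, hT_eq_hF_cc hMh1 hP4 c, Equiv.symm_apply_apply]

/-- `σ_□` commutes with every torus translation. [cite: Balaban1983RegularityDecay, p.572, dictionary] -/
theorem σch_tshift (v : Fin (d + 1) → ℤ) (z : ↥(boxDom (N0 ℓ Mh k P'))) : σch D c (tshift (N0 ℓ Mh k P') v z) = tshift (N0 ℓ Mh k P') v (σch D c z) := by
  show tshift _ _ (tshift _ v z) = tshift _ v (tshift _ _ z)
  rw [tshift_tshift, tshift_tshift, add_comm v]

/-- **THE FIRST-STEP SIZE OF `h^ch_□`**: `|h^ch_□(x + e_μ) − h^ch_□(x)| ≤ C1F/(8S/5)` (torus neighbours under `σ_□ ∘ toBox`).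
[cite: Balaban1984PropagatorsII, p.247 («|∂h_□| ≤ O(1)(ML^jη)^{−1}»)] -/
theorem abs_hch_shift_sub_le (hMhL : 2 * (ℓ + 1) ≤ Mh) (hR : 2 * (ℓ + 1) ≤ R) (hP5 : ∀ μ, 5 ≤ P' μ) (x : Site (PV d ℓ m K hd hL) 0)
    (dir μ : Fin (d + 1)) :
    |B6CubeWindowV1L0.hch hN hMh1 hP4 c ⟨x.shift μ, dir⟩ - hch hN hMh1 hP4 c ⟨x, dir⟩| ≤ C1F d ℓ / (8 / 5 * (bigSide ℓ Mh c.1.1 : ℝ)) := by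
  rw [hch_eq_hT, hch_eq_hT]
  dsimp only
  rw [toBox_shift hN, σch_tshift]
  refine abs_hT_sub_le_near (one_le_ell hL) hMhL hR hP5 c ?_
  rw [show (σch D c (toBox hN x)).1 - (tshift (N0 ℓ Mh k P') (unitVec μ) (σch D c (toBox hN x))).1 =
      -((tshift (N0 ℓ Mh k P') (unitVec μ) (σch D c (toBox hN x))).1 - (σch D c (toBox hN x)).1) by abel,
    torusSupNorm_neg (one_le_of_mem (σch D c (toBox hN x)).2)]
  exact torusSupNorm_tshift_unitVec_le (one_le_of_mem (σch D c (toBox hN x)).2) μ _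

/-- **THE FIRST-STEP SIZE, BACKWARDS**: `|h^ch_□(x − e_μ) − h^ch_□(x)| ≤ C1F/(8S/5)`. [cite: Balaban1984PropagatorsII, p.247] -/
theorem abs_hch_unshift_sub_le (hMhL : 2 * (ℓ + 1) ≤ Mh) (hR : 2 * (ℓ + 1) ≤ R) (hP5 : ∀ μ, 5 ≤ P' μ) (x : Site (PV d ℓ m K hd hL) 0)
    (dir μ : Fin (d + 1)) :
    |B6CubeWindowV1L0.hch hN hMh1 hP4 c ⟨x.unshift μ, dir⟩ - hch hN hMh1 hP4 c ⟨x, dir⟩| ≤ C1F d ℓ / (8 / 5 * (bigSide ℓ Mh c.1.1 : ℝ)) := by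
  have h := abs_hch_shift_sub_le hN hMh1 hP4 c hMhL hR hP5 (x.unshift μ) dir μ
  rw [shift_unshift] at h
  rwa [abs_sub_comm] at h

/-- **THE SECOND-STEP SIZE OF `h^ch_□`**: `|h^ch_□(x + e_μ) − 2h^ch_□(x) + h^ch_□(x − e_μ)| ≤ C2F/(8S/5)²`.
[cite: Balaban1984PropagatorsII, p.247 («|Δh_□| ≤ O(1)M^{−1}(L^jη)^{−2}»)] -/
theorem abs_hch_second_le (hR : 2 * (ℓ + 1) ≤ R) (hP5 : ∀ μ, 5 ≤ P' μ) (hMh : 2 ≤ Mh) (x : Site (PV d ℓ m K hd hL) 0)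
    (dir μ : Fin (d + 1)) :
    |B6CubeWindowV1L0.hch hN hMh1 hP4 c ⟨x.shift μ, dir⟩ - 2 * hch hN hMh1 hP4 c ⟨x, dir⟩ + hch hN hMh1 hP4 c ⟨x.unshift μ, dir⟩|
      ≤ C2F d ℓ / (8 / 5 * (bigSide ℓ Mh c.1.1 : ℝ)) ^ 2 := by
  rw [hch_eq_hT, hch_eq_hT, hch_eq_hT]
  dsimp only
  rw [toBox_shift hN, toBox_unshift hN, σch_tshift, σch_tshift]
  exact abs_hT_second_diff_le (one_le_ell hL) hMh hR hP5 c μ _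

/-- **THE BLOCKS AROUND `supp h^ch_□` ARE BLOCKS OF THE REACH**: `h^ch_□(x′) ≠ 0` for a lattice neighbour `x′ ∈ {x, x ± e_μ}` ⟹ the torus block of
`σ_□(toBox x)` lies in `QT □`. [cite: Balaban1984PropagatorsII, p.239/p.247 (supports of h_□, ζ_□ in □̃ — our paraphrase of p.239 «equal to 1 on a cube containing □ … equal to 0 outside a similar cube», not a printed sentence), p.235] -/
theorem blkOf_σch_mem_QT (hM8 : 8 ≤ Mh) (hR : 2 * (ℓ + 1) ≤ R) (hP5 : ∀ μ, 5 ≤ P' μ) (x : Site (PV d ℓ m K hd hL) 0)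
    {dir : Fin (d + 1)} {μ : Fin (d + 1)}
    (h : B6CubeWindowV1L0.hch hN hMh1 hP4 c ⟨x, dir⟩ ≠ 0 ∨ hch hN hMh1 hP4 c ⟨x.shift μ, dir⟩ ≠ 0 ∨ hch hN hMh1 hP4 c ⟨x.unshift μ, dir⟩ ≠ 0) :
    blkOf D.toDomains (σch D c (toBox hN x)) ∈ QT D hMh1 hP4 c := by
  have hℓ : 1 ≤ ℓ := one_le_ell hL
  have hMh : 2 ≤ Mh := le_trans (by norm_num) hM8
  have h1 : ∀ i, 1 ≤ N0 ℓ Mh k P' i := one_le_of_mem (σch D c (toBox hN x)).2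
  rcases h with h | h | h
  · rw [hch_eq_hT] at h
    exact blkOf_mem_QT_of_hT_ne_zero hMh hR hP4 c h
  · rw [hch_eq_hT] at h
    dsimp only at h
    rw [toBox_shift hN, σch_tshift] at h
    refine blkOf_mem_QT_of_near_hT D hℓ hM8 hR hP5 hP4 c h ?_
    rw [show (σch D c (toBox hN x)).1 - (tshift (N0 ℓ Mh k P') (unitVec μ) (σch D c (toBox hN x))).1 =
        -((tshift (N0 ℓ Mh k P') (unitVec μ) (σch D c (toBox hN x))).1 - (σch D c (toBox hN x)).1) by abel, torusSupNorm_neg h1]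
    exact torusSupNorm_tshift_unitVec_le h1 μ _
  · rw [hch_eq_hT] at h
    dsimp only at h
    rw [toBox_unshift hN, σch_tshift] at h
    refine blkOf_mem_QT_of_near_hT D hℓ hM8 hR hP5 hP4 c h ?_
    rw [show (σch D c (toBox hN x)).1 - (tshift (N0 ℓ Mh k P') (-unitVec μ) (σch D c (toBox hN x))).1 =
        -((tshift (N0 ℓ Mh k P') (-unitVec μ) (σch D c (toBox hN x))).1 - (σch D c (toBox hN x)).1) by abel, torusSupNorm_neg h1]
    exact torusSupNorm_tshift_neg_unitVec_le h1 μ _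

/-- the torus block of the translated bond: `blkV1(b + v_□) = blkOf(σ_□(toBox b₋))`. [cite: Balaban1984PropagatorsII, (2.45) p.231, dictionary (charts)] -/
theorem blkV1_translate_vch (b : PBond (PV d ℓ m K hd hL) 0) :
    B6GlobalChartV1L0.blkV1 hN D (b.translate (vch Mh k (svec ℓ k c.1.1 c.1.2))) = blkOf D.toDomains (σch D c (toBox hN b.src)) := by
  unfold blkV1
  rw [PBond.translate_src, toBox_add_tv]

end Chart

/-! ## §3  (v1.1) — the window-side lemmas of the original (`restrictB_*'`, `extend_*`) are `D`-free (two-scale window only) and are opened BY NAME above -/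

/-! ## §4  (v1.1) THE BINDERS `hcf`, `hcfT`, `hc₀`, `hc₀T` OF `h2134_kFam_torus_in` FOR THE CUBE'S `cfC`, `c0C` -/

section Coeff

open B6Ineq2133TwoScaleV1 (onFun onFun_apply)
open B6GlobalChartV1 (PV toBox)
open B6GlobalChartV1L0 (domT blkV1)
open B6SectAOperatorsV1 (BondIdx)
open B6Prop25TwoScaleCensus (TSIdx)
open B6AgreeLapV1Chart (cB eB eS DeepS mem_cB_W deepS_mono)
open B6Prop26ReachTransplant (restrictOp extendOp extendOp_apply)
open B6TranslateV1 (trV trV_apply)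
open B6TranslateTorusV1 (vch)
open B6Geom246MultiLevelTorusL0 (geomT blkMap)
open B8Ineq192MultiLevelTorusL0 (geomTB geomTB_len geomTB_M)
open B6Cover236MultiLevelBlocksL0 (window)
open B6Prop26KLevelSkeletonV1L0 (ST mem_ST)
open B6CubeWindowV1 (x0 Placed)
open B6CubeWindowV1L0 (tC tC_j sc hx0 hfit wC hch hch_deep j0 j0_le_level)
open B6Eq292MemberTorusV1L0 (cfC c0C)
open B10StarCount (shift_unshift unshift_shift)

variable {hd : 1 ≤ d + 1} {hL : Odd (ℓ + 1) ∧ 1 < ℓ + 1} {a₀ a₁ : ℝ} {m K : ℕ} {Mh k R : ℕ} {P' : Fin (d + 1) → ℕ}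
variable (hN : ∀ μ, N0 ℓ Mh k P' μ = (PV d ℓ m K hd hL).sitesPerDir 0) {D : TDomains d ℓ Mh k P' R} (hk : k ≤ m + K)
  (hMh1 : 1 ≤ Mh) (hP4 : ∀ μ, 4 ≤ P' μ) {a : ℕ} (hMha : Mh = (ℓ + 1) ^ a) (c : ↥(cubes D.toDomains)) (ha : a₀ ≤ a₁)

/-- `(x − v) + v = x` for bonds. [folklore] -/
private theorem translate_neg_translate {P : Params} (v : Site P 0) (x : PBond P 0) : (x.translate (-v)).translate v = x :=
  (PBond.translateEquiv v).apply_symm_apply x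

/-- **THE BLOCKS OF `□⁺ = QT □` HAVE LEVEL `≤ j + 1`** (the two-level window of the reach). [cite: Balaban1984PropagatorsII, p.235 («either □̃ ⊂ B^j(Λ_j), or it intersects B^{j+1}(Λ_{j+1}) also»), (2.2) p.224] -/
theorem level_le_of_mem_QT (hR : 2 * (ℓ + 1) ≤ R) {y : ↥(B6Geom246MultiLevelBoxL0.bset D.toDomains)} (hy : y ∈ QT D hMh1 hP4 c) : y.1.1 ≤ c.1.1 + 1 := by
  obtain ⟨y', hy', rfl⟩ := Finset.mem_image.1 hy
  rw [B6TranslateTorusV1L0.blkMap_fst D hMh1 (fun μ => le_trans (by norm_num) (hP4 μ))]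
  exact (window (Dch D c) hMh1 hR hy').2

include hMha in
/-- `supp h^ch_□` has margin `1` in the window of the member (it has margin `4L^{j₀+1}`, r03's `hch_deep`). [cite: Balaban1984PropagatorsII, p.238 (□ ⊂ □̃³), bookkeeping] -/
theorem hch_deep1 (hM8 : 8 ≤ Mh) (hR2 : 2 * (ℓ + 1) ^ 2 ≤ R) (w : BondIdx (B6GlobalChartV1L0.domT hN D hk) → ℝ) (cf : ℝ)
    (b : PBond (PV d ℓ m K hd hL) 0) (hb : hch hN hMh1 hP4 c b ≠ 0) :
    b.src ∈ DeepS (tC hN hk hMh1 hP4 c ha a (wC hN hk c w) cf) (x0 ℓ Mh k c.1) 1 :=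
  deepS_mono (Nat.succ_le_of_lt (by positivity)) (hch_deep hN hMh1 hP4 hMha c ha hM8 hR2 hb)

/-- **THE CHART-FRAME VALUE OF `c_e`**: `|ε(s(□)•E_e(ρh^ch_□))(b)| ≤ s(□)·L^{j₀}·C1F/(8S/5)` for every bond `b` (`M_h ≥ 8`, `R ≥ 2L²`, `P′ ≥ 5`):
the window-side difference is the honest nearest-neighbour difference of `h^ch_□` (§3), whose size is (1.118)'s (§2).
[cite: Balaban1984PropagatorsII, p.247 («|∂h_□| ≤ O(1)(ML^jη)^{−1}»), (2.92) p.239 (line 1), (2.94) p.239] -/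
theorem abs_cfC_chart_le (hM8 : 8 ≤ Mh) (hMhL : 2 * (ℓ + 1) ≤ Mh) (hR2 : 2 * (ℓ + 1) ^ 2 ≤ R) (hP5 : ∀ μ, 5 ≤ P' μ) (hpl : Placed ℓ k P' c.1)
    (w : BondIdx (B6GlobalChartV1L0.domT hN D hk) → ℝ) (cf : ℝ) (e : Fin (d + 1) × Bool) (b : PBond (PV d ℓ m K hd hL) 0) :
    |extendOp (cB (tC hN hk hMh1 hP4 c ha a (wC hN hk c w) cf) (x0 ℓ Mh k c.1) (hx0 hpl) (hfit hN hMh1 hP4 hMha c ha hpl)).W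
        (eB (tC hN hk hMh1 hP4 c ha a (wC hN hk c w) cf) (x0 ℓ Mh k c.1))
        (sc hMh1 hP4 c cf • onFun (if e.2 then (tC hN hk hMh1 hP4 c ha a (wC hN hk c w) cf).Dl e.1 else (tC hN hk hMh1 hP4 c ha a (wC hN hk c w) cf).Dla e.1)
          (restrictOp (cB (tC hN hk hMh1 hP4 c ha a (wC hN hk c w) cf) (x0 ℓ Mh k c.1) (hx0 hpl) (hfit hN hMh1 hP4 hMha c ha hpl)).W
            (eB (tC hN hk hMh1 hP4 c ha a (wC hN hk c w) cf) (x0 ℓ Mh k c.1)) (hch hN hMh1 hP4 c))) b|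
      ≤ sc hMh1 hP4 c cf * (((ℓ + 1 : ℕ) : ℝ)) ^ j0 hMh1 hP4 c * (C1F d ℓ / (8 / 5 * (bigSide ℓ Mh c.1.1 : ℝ))) := by
  have hR : 2 * (ℓ + 1) ≤ R := le_trans (by nlinarith : 2 * (ℓ + 1) ≤ 2 * (ℓ + 1) ^ 2) hR2
  have hsc : 0 ≤ sc hMh1 hP4 c cf := by unfold sc; positivity
  have hnn : 0 ≤ sc hMh1 hP4 c cf * (((ℓ + 1 : ℕ) : ℝ)) ^ j0 hMh1 hP4 c * (C1F d ℓ / (8 / 5 * (bigSide ℓ Mh c.1.1 : ℝ))) := by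
    have := C1F_nonneg d ℓ
    positivity
  have hh := hch_deep1 hN hk hMh1 hP4 hMha c ha hM8 hR2 w cf
  obtain ⟨y, ν⟩ := b
  by_cases hy : y ∈ DeepS (tC hN hk hMh1 hP4 c ha a (wC hN hk c w) cf) (x0 ℓ Mh k c.1) 0
  · have hLj : (0 : ℝ) ≤ (((ℓ + 1 : ℕ) : ℝ)) ^ j0 hMh1 hP4 c := by positivity
    obtain ⟨μ, s⟩ := e
    cases s
    · simp only [Bool.false_eq_true, if_false]
      rw [extend_smul_Dla_apply _ hh μ y ν hy, tC_j, abs_mul, abs_mul, abs_of_nonneg hsc, abs_of_nonneg hLj, ← mul_assoc]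
      exact mul_le_mul_of_nonneg_left (abs_hch_unshift_sub_le hN hMh1 hP4 c hMhL hR hP5 y ν μ) (mul_nonneg hsc hLj)
    · simp only [if_true]
      rw [extend_smul_Dl_apply _ hh μ y ν hy, tC_j, abs_mul, abs_mul, abs_of_nonneg hsc, abs_of_nonneg hLj, ← mul_assoc]
      exact mul_le_mul_of_nonneg_left (abs_hch_shift_sub_le hN hMh1 hP4 c hMhL hR hP5 y ν μ) (mul_nonneg hsc hLj)
  · rw [extend_apply_of_not_mem _ hy, abs_zero]
    exact hnn

/-- **THE CHART-FRAME SUPPORT OF `c_e`**: `ε(s(□)•E_e(ρh^ch_□))(b) ≠ 0 ⟹` the torus block of `σ_□(toBox b₋)` lies in `QT □` (the coefficient is a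
difference of `h^ch_□` at `b` and a lattice neighbour; §2 `blkOf_σch_mem_QT`). [cite: Balaban1984PropagatorsII, p.239/p.247 (supports of h_□, ζ_□ in □̃ — our paraphrase of p.239 «equal to 1 on a cube containing □ … equal to 0 outside a similar cube», not a printed sentence), p.235] -/
theorem blkOf_mem_QT_of_cfC_chart_ne_zero (hM8 : 8 ≤ Mh) (hR2 : 2 * (ℓ + 1) ^ 2 ≤ R) (hP5 : ∀ μ, 5 ≤ P' μ) (hpl : Placed ℓ k P' c.1)
    (w : BondIdx (B6GlobalChartV1L0.domT hN D hk) → ℝ) (cf : ℝ) (e : Fin (d + 1) × Bool) (b : PBond (PV d ℓ m K hd hL) 0)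
    (hb : extendOp (cB (tC hN hk hMh1 hP4 c ha a (wC hN hk c w) cf) (x0 ℓ Mh k c.1) (hx0 hpl) (hfit hN hMh1 hP4 hMha c ha hpl)).W
        (eB (tC hN hk hMh1 hP4 c ha a (wC hN hk c w) cf) (x0 ℓ Mh k c.1))
        (sc hMh1 hP4 c cf • onFun (if e.2 then (tC hN hk hMh1 hP4 c ha a (wC hN hk c w) cf).Dl e.1 else (tC hN hk hMh1 hP4 c ha a (wC hN hk c w) cf).Dla e.1)
          (restrictOp (cB (tC hN hk hMh1 hP4 c ha a (wC hN hk c w) cf) (x0 ℓ Mh k c.1) (hx0 hpl) (hfit hN hMh1 hP4 hMha c ha hpl)).W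
            (eB (tC hN hk hMh1 hP4 c ha a (wC hN hk c w) cf) (x0 ℓ Mh k c.1)) (hch hN hMh1 hP4 c))) b ≠ 0) :
    blkOf D.toDomains (σch D c (toBox hN b.src)) ∈ QT D hMh1 hP4 c := by
  have hR : 2 * (ℓ + 1) ≤ R := le_trans (by nlinarith : 2 * (ℓ + 1) ≤ 2 * (ℓ + 1) ^ 2) hR2
  have hh := hch_deep1 hN hk hMh1 hP4 hMha c ha hM8 hR2 w cf
  obtain ⟨y, ν⟩ := b
  by_cases hy : y ∈ DeepS (tC hN hk hMh1 hP4 c ha a (wC hN hk c w) cf) (x0 ℓ Mh k c.1) 0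
  · obtain ⟨μ, s⟩ := e
    cases s
    · simp only [Bool.false_eq_true, if_false] at hb
      rw [extend_smul_Dla_apply _ hh μ y ν hy] at hb
      have hne : hch hN hMh1 hP4 c ⟨y, ν⟩ ≠ 0 ∨ hch hN hMh1 hP4 c ⟨y.shift μ, ν⟩ ≠ 0 ∨ hch hN hMh1 hP4 c ⟨y.unshift μ, ν⟩ ≠ 0 := by
        by_contra hcon
        push Not at hcon
        obtain ⟨h1, -, h3⟩ := hcon
        exact hb (by rw [h1, h3]; ring)
      exact blkOf_σch_mem_QT hN hMh1 hP4 c hM8 hR hP5 y hne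
    · simp only [if_true] at hb
      rw [extend_smul_Dl_apply _ hh μ y ν hy] at hb
      have hne : hch hN hMh1 hP4 c ⟨y, ν⟩ ≠ 0 ∨ hch hN hMh1 hP4 c ⟨y.shift μ, ν⟩ ≠ 0 ∨ hch hN hMh1 hP4 c ⟨y.unshift μ, ν⟩ ≠ 0 := by
        by_contra hcon
        push Not at hcon
        obtain ⟨h1, h2, -⟩ := hcon
        exact hb (by rw [h1, h2]; ring)
      exact blkOf_σch_mem_QT hN hMh1 hP4 c hM8 hR hP5 y hne
  · exact absurd (extend_apply_of_not_mem _ hy) hb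

/-- **THE CHART-FRAME VALUE OF `c₀`**: `|ε(s(□)•Δ(ρh^ch_□))(b)| ≤ s(□)·(d+1)·L^{2j₀}·C2F/(8S/5)²`.
[cite: Balaban1984PropagatorsII, p.247 («|Δh_□| ≤ O(1)M^{−1}(L^jη)^{−2}»), (2.92) p.239 (line 1), (2.94) p.239] -/
theorem abs_c0C_chart_le (hM8 : 8 ≤ Mh) (hR2 : 2 * (ℓ + 1) ^ 2 ≤ R) (hP5 : ∀ μ, 5 ≤ P' μ) (hpl : Placed ℓ k P' c.1)
    (w : BondIdx (B6GlobalChartV1L0.domT hN D hk) → ℝ) (cf : ℝ) (b : PBond (PV d ℓ m K hd hL) 0) :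
    |extendOp (cB (tC hN hk hMh1 hP4 c ha a (wC hN hk c w) cf) (x0 ℓ Mh k c.1) (hx0 hpl) (hfit hN hMh1 hP4 hMha c ha hpl)).W
        (eB (tC hN hk hMh1 hP4 c ha a (wC hN hk c w) cf) (x0 ℓ Mh k c.1))
        (sc hMh1 hP4 c cf • onFun (tC hN hk hMh1 hP4 c ha a (wC hN hk c w) cf).lapTS
          (restrictOp (cB (tC hN hk hMh1 hP4 c ha a (wC hN hk c w) cf) (x0 ℓ Mh k c.1) (hx0 hpl) (hfit hN hMh1 hP4 hMha c ha hpl)).W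
            (eB (tC hN hk hMh1 hP4 c ha a (wC hN hk c w) cf) (x0 ℓ Mh k c.1)) (hch hN hMh1 hP4 c))) b|
      ≤ sc hMh1 hP4 c cf * (((d : ℝ) + 1) * (((((ℓ + 1 : ℕ) : ℝ)) ^ j0 hMh1 hP4 c) ^ 2 * (C2F d ℓ / (8 / 5 * (bigSide ℓ Mh c.1.1 : ℝ)) ^ 2))) := by
  have hR : 2 * (ℓ + 1) ≤ R := le_trans (by nlinarith : 2 * (ℓ + 1) ≤ 2 * (ℓ + 1) ^ 2) hR2
  have hMh : 2 ≤ Mh := le_trans (by norm_num) hM8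
  have hsc : 0 ≤ sc hMh1 hP4 c cf := by unfold sc; positivity
  have hC2 := C2F_nonneg d ℓ
  have hterm : 0 ≤ ((((ℓ + 1 : ℕ) : ℝ)) ^ j0 hMh1 hP4 c) ^ 2 * (C2F d ℓ / (8 / 5 * (bigSide ℓ Mh c.1.1 : ℝ)) ^ 2) := by positivity
  have hh := hch_deep1 hN hk hMh1 hP4 hMha c ha hM8 hR2 w cf
  obtain ⟨y, ν⟩ := b
  by_cases hy : y ∈ DeepS (tC hN hk hMh1 hP4 c ha a (wC hN hk c w) cf) (x0 ℓ Mh k c.1) 0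
  · rw [extend_smul_lapTS_apply _ hh y ν hy, tC_j, abs_mul, abs_of_nonneg hsc]
    refine mul_le_mul_of_nonneg_left ?_ hsc
    refine (Finset.abs_sum_le_sum_abs _ _).trans ?_
    have hcard : (Finset.univ : Finset (Fin (d + 1))).card = d + 1 := Finset.card_fin _
    calc ∑ μ : Fin (d + 1), |((((ℓ + 1 : ℕ) : ℝ)) ^ j0 hMh1 hP4 c) ^ 2 *
            (2 * hch hN hMh1 hP4 c ⟨y, ν⟩ - hch hN hMh1 hP4 c ⟨y.unshift μ, ν⟩ - hch hN hMh1 hP4 c ⟨y.shift μ, ν⟩)|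
        ≤ ∑ _μ : Fin (d + 1), ((((ℓ + 1 : ℕ) : ℝ)) ^ j0 hMh1 hP4 c) ^ 2 * (C2F d ℓ / (8 / 5 * (bigSide ℓ Mh c.1.1 : ℝ)) ^ 2) := by
          refine Finset.sum_le_sum fun μ _ => ?_
          have hLj2 : (0 : ℝ) ≤ ((((ℓ + 1 : ℕ) : ℝ)) ^ j0 hMh1 hP4 c) ^ 2 := by positivity
          rw [abs_mul, abs_of_nonneg hLj2]
          refine mul_le_mul_of_nonneg_left ?_ hLj2
          have h2 := abs_hch_second_le hN hMh1 hP4 c hR hP5 hMh y ν μ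
          rw [show 2 * hch hN hMh1 hP4 c ⟨y, ν⟩ - hch hN hMh1 hP4 c ⟨y.unshift μ, ν⟩ - hch hN hMh1 hP4 c ⟨y.shift μ, ν⟩ =
            -(hch hN hMh1 hP4 c ⟨y.shift μ, ν⟩ - 2 * hch hN hMh1 hP4 c ⟨y, ν⟩ + hch hN hMh1 hP4 c ⟨y.unshift μ, ν⟩) by ring, abs_neg]
          exact h2
      _ = ((d : ℝ) + 1) * (((((ℓ + 1 : ℕ) : ℝ)) ^ j0 hMh1 hP4 c) ^ 2 * (C2F d ℓ / (8 / 5 * (bigSide ℓ Mh c.1.1 : ℝ)) ^ 2)) := by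
          rw [Finset.sum_const, hcard, nsmul_eq_mul]; push_cast; ring
  · rw [extend_apply_of_not_mem _ hy, abs_zero]
    positivity

/-- **THE CHART-FRAME SUPPORT OF `c₀`**. [cite: Balaban1984PropagatorsII, p.239/p.247 (supports of h_□, ζ_□ in □̃ — our paraphrase of p.239 «equal to 1 on a cube containing □ … equal to 0 outside a similar cube», not a printed sentence), p.235] -/
theorem blkOf_mem_QT_of_c0C_chart_ne_zero (hM8 : 8 ≤ Mh) (hR2 : 2 * (ℓ + 1) ^ 2 ≤ R) (hP5 : ∀ μ, 5 ≤ P' μ) (hpl : Placed ℓ k P' c.1)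
    (w : BondIdx (B6GlobalChartV1L0.domT hN D hk) → ℝ) (cf : ℝ) (b : PBond (PV d ℓ m K hd hL) 0)
    (hb : extendOp (cB (tC hN hk hMh1 hP4 c ha a (wC hN hk c w) cf) (x0 ℓ Mh k c.1) (hx0 hpl) (hfit hN hMh1 hP4 hMha c ha hpl)).W
        (eB (tC hN hk hMh1 hP4 c ha a (wC hN hk c w) cf) (x0 ℓ Mh k c.1))
        (sc hMh1 hP4 c cf • onFun (tC hN hk hMh1 hP4 c ha a (wC hN hk c w) cf).lapTS
          (restrictOp (cB (tC hN hk hMh1 hP4 c ha a (wC hN hk c w) cf) (x0 ℓ Mh k c.1) (hx0 hpl) (hfit hN hMh1 hP4 hMha c ha hpl)).W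
            (eB (tC hN hk hMh1 hP4 c ha a (wC hN hk c w) cf) (x0 ℓ Mh k c.1)) (hch hN hMh1 hP4 c))) b ≠ 0) :
    blkOf D.toDomains (σch D c (toBox hN b.src)) ∈ QT D hMh1 hP4 c := by
  have hR : 2 * (ℓ + 1) ≤ R := le_trans (by nlinarith : 2 * (ℓ + 1) ≤ 2 * (ℓ + 1) ^ 2) hR2
  have hMh : 2 ≤ Mh := le_trans (by norm_num) hM8
  have hh := hch_deep1 hN hk hMh1 hP4 hMha c ha hM8 hR2 w cf
  obtain ⟨y, ν⟩ := b
  by_cases hy : y ∈ DeepS (tC hN hk hMh1 hP4 c ha a (wC hN hk c w) cf) (x0 ℓ Mh k c.1) 0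
  · rw [extend_smul_lapTS_apply _ hh y ν hy] at hb
    -- `h^ch_□(y, ν) ≠ 0`, or some neighbour value is non-zero
    by_cases h0 : hch hN hMh1 hP4 c ⟨y, ν⟩ ≠ 0
    · exact blkOf_σch_mem_QT hN hMh1 hP4 c hM8 hR hP5 y (μ := ν) (Or.inl h0)
    · push Not at h0
      have hsum : ∑ μ : Fin (d + 1), ((((ℓ + 1 : ℕ) : ℝ)) ^ (tC hN hk hMh1 hP4 c ha a (wC hN hk c w) cf).j) ^ 2 *
          (2 * hch hN hMh1 hP4 c ⟨y, ν⟩ - hch hN hMh1 hP4 c ⟨y.unshift μ, ν⟩ - hch hN hMh1 hP4 c ⟨y.shift μ, ν⟩) ≠ 0 := by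
        intro hs; exact hb (by rw [hs, mul_zero])
      obtain ⟨μ, -, hμ⟩ := Finset.exists_ne_zero_of_sum_ne_zero hsum
      have hne : hch hN hMh1 hP4 c ⟨y, ν⟩ ≠ 0 ∨ hch hN hMh1 hP4 c ⟨y.shift μ, ν⟩ ≠ 0 ∨ hch hN hMh1 hP4 c ⟨y.unshift μ, ν⟩ ≠ 0 := by
        by_contra hcon
        push Not at hcon
        obtain ⟨-, h2, h3⟩ := hcon
        exact hμ (by rw [h0, h2, h3]; ring)
      exact blkOf_σch_mem_QT hN hMh1 hP4 c hM8 hR hP5 y hne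
  · exact absurd (extend_apply_of_not_mem _ hy) hb

/-- **`hcfT` FOR THE CUBE**: `c_e(x) ≠ 0 ⟹ y(x₋) ∈ Q^T_□` — the line-1 first-order coefficients of the genuine member live over the reach `□⁺`.
[cite: Balaban1984PropagatorsII, p.239/p.247 (supports of h_□, ζ_□ in □̃ — our paraphrase of p.239 «equal to 1 on a cube containing □ … equal to 0 outside a similar cube», not a printed sentence), (2.92) p.239 (line 1), (2.134) p.247] -/
theorem cfC_supp (hM8 : 8 ≤ Mh) (hR2 : 2 * (ℓ + 1) ^ 2 ≤ R) (hP5 : ∀ μ, 5 ≤ P' μ) (hpl : Placed ℓ k P' c.1)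
    (w : BondIdx (B6GlobalChartV1L0.domT hN D hk) → ℝ) (cf : ℝ) (e : Fin (d + 1) × Bool) (x : PBond (PV d ℓ m K hd hL) 0)
    (hx : cfC hN hk hMh1 hP4 hMha c ha hpl w cf e x ≠ 0) : blkV1 hN D x ∈ ST D hMh1 hP4 c := by
  unfold cfC at hx
  rw [trV_apply] at hx
  have key := blkOf_mem_QT_of_cfC_chart_ne_zero hN hk hMh1 hP4 hMha c ha hM8 hR2 hP5 hpl w cf e _ hx
  rw [← blkV1_translate_vch hN c, translate_neg_translate] at key
  exact (mem_ST D hMh1 hP4 c _).2 key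

/-- **`hc₀T` FOR THE CUBE**: `c₀(x) ≠ 0 ⟹ y(x₋) ∈ Q^T_□`. [cite: Balaban1984PropagatorsII, p.239/p.247 (supports of h_□, ζ_□ in □̃ — our paraphrase of p.239 «equal to 1 on a cube containing □ … equal to 0 outside a similar cube», not a printed sentence), (2.92) p.239 (line 1), (2.134) p.247] -/
theorem c0C_supp (hM8 : 8 ≤ Mh) (hR2 : 2 * (ℓ + 1) ^ 2 ≤ R) (hP5 : ∀ μ, 5 ≤ P' μ) (hpl : Placed ℓ k P' c.1)
    (w : BondIdx (B6GlobalChartV1L0.domT hN D hk) → ℝ) (cf : ℝ) (x : PBond (PV d ℓ m K hd hL) 0)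
    (hx : c0C hN hk hMh1 hP4 hMha c ha hpl w cf x ≠ 0) : blkV1 hN D x ∈ ST D hMh1 hP4 c := by
  unfold c0C at hx
  rw [trV_apply] at hx
  have key := blkOf_mem_QT_of_c0C_chart_ne_zero hN hk hMh1 hP4 hMha c ha hM8 hR2 hP5 hpl w cf _ hx
  rw [← blkV1_translate_vch hN c, translate_neg_translate] at key
  exact (mem_ST D hMh1 hP4 c _).2 key

/-- the exponent bookkeeping of `hcf`: on a block `y ∈ Q^T_□` (level `j(y) ≤ j + 1`, `j ≤ j₀ + 1`):
`s(□)·L^{j₀}·C1F/(8S/5) ≤ C1F·L³·c′²/(M·len(y)²)` (`M = L·M_h`, `S = M_h L^{j+1}`, `len(y) = L^{j(y)}`, `s(□) = (c′/L^{j₀})²`).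
[cite: Balaban1984PropagatorsII, p.247 («|∂h_□| ≤ O(1)(ML^jη)^{−1}»), (2.94) p.239, bookkeeping] -/
theorem cfC_value_le (hL2 : Odd (ℓ + 1) ∧ 1 < ℓ + 1) (hR2 : 2 * (ℓ + 1) ^ 2 ≤ R) (cf : ℝ) {y : ↥(B6Geom246MultiLevelBoxL0.bset D.toDomains)} (hy : y ∈ QT D hMh1 hP4 c) :
    sc hMh1 hP4 c cf * (((ℓ + 1 : ℕ) : ℝ)) ^ j0 hMh1 hP4 c * (C1F d ℓ / (8 / 5 * (bigSide ℓ Mh c.1.1 : ℝ)))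
      ≤ C1F d ℓ * ((ℓ : ℝ) + 1) ^ 3 * cf ^ 2 / ((geomTB D).M * (geomTB D).len y ^ 2) := by
  have hR : 2 * (ℓ + 1) ≤ R := le_trans (by nlinarith : 2 * (ℓ + 1) ≤ 2 * (ℓ + 1) ^ 2) hR2
  have hjy := level_le_of_mem_QT hMh1 hP4 c hR hy
  have hj0 := j0_le_level hMh1 hP4 c hL2 hR2
  have hC1 := C1F_nonneg d ℓ
  have hMpos : (0 : ℝ) < Mh := by exact_mod_cast hMh1
  have hM0 : (Mh : ℝ) ≠ 0 := hMpos.ne'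
  have hL1 : (1 : ℝ) ≤ (ℓ : ℝ) + 1 := by linarith [(Nat.cast_nonneg ℓ : (0 : ℝ) ≤ ℓ)]
  have hLpos : (0 : ℝ) < (ℓ : ℝ) + 1 := by linarith
  have hL0 : (ℓ : ℝ) + 1 ≠ 0 := hLpos.ne'
  -- both sides are `c′²·C1F ×` a monomial in `L`, `M_h`; normalise and compare the monomials
  have e1 : sc hMh1 hP4 c cf * (((ℓ + 1 : ℕ) : ℝ)) ^ j0 hMh1 hP4 c * (C1F d ℓ / (8 / 5 * (bigSide ℓ Mh c.1.1 : ℝ)))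
      = cf ^ 2 * C1F d ℓ * 5 / (8 * (Mh : ℝ) * ((ℓ : ℝ) + 1) ^ (j0 hMh1 hP4 c + c.1.1 + 1)) := by
    unfold sc bigSide
    push_cast
    field_simp
    ring
  have e2 : C1F d ℓ * ((ℓ : ℝ) + 1) ^ 3 * cf ^ 2 / ((geomTB D).M * (geomTB D).len y ^ 2)
      = cf ^ 2 * C1F d ℓ * ((ℓ : ℝ) + 1) ^ 3 / ((Mh : ℝ) * ((ℓ : ℝ) + 1) ^ (2 * y.1.1 + 1)) := by
    rw [geomTB_M, geomTB_len]
    field_simp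
    ring
  rw [e1, e2, div_le_div_iff₀ (by positivity) (by positivity)]
  have hpow : ((ℓ : ℝ) + 1) ^ (2 * y.1.1 + 1) ≤ ((ℓ : ℝ) + 1) ^ (j0 hMh1 hP4 c + c.1.1 + 4) :=
    pow_le_pow_right₀ hL1 (by omega)
  have hmono : 5 * ((ℓ : ℝ) + 1) ^ (2 * y.1.1 + 1) ≤ 8 * ((ℓ : ℝ) + 1) ^ (j0 hMh1 hP4 c + c.1.1 + 4) := by
    have h0 : 0 ≤ ((ℓ : ℝ) + 1) ^ (j0 hMh1 hP4 c + c.1.1 + 4) := by positivity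
    nlinarith
  calc cf ^ 2 * C1F d ℓ * 5 * ((Mh : ℝ) * ((ℓ : ℝ) + 1) ^ (2 * y.1.1 + 1))
      = cf ^ 2 * C1F d ℓ * (Mh : ℝ) * (5 * ((ℓ : ℝ) + 1) ^ (2 * y.1.1 + 1)) := by ring
    _ ≤ cf ^ 2 * C1F d ℓ * (Mh : ℝ) * (8 * ((ℓ : ℝ) + 1) ^ (j0 hMh1 hP4 c + c.1.1 + 4)) :=
        mul_le_mul_of_nonneg_left hmono (by positivity)
    _ = cf ^ 2 * C1F d ℓ * ((ℓ : ℝ) + 1) ^ 3 * (8 * (Mh : ℝ) * ((ℓ : ℝ) + 1) ^ (j0 hMh1 hP4 c + c.1.1 + 1)) := by ring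

/-- the exponent bookkeeping of `hc₀`: on `y ∈ Q^T_□`: `s(□)·(d+1)·L^{2j₀}·C2F/(8S/5)² ≤ (d+1)·C2F·L·c′²/(M·len(y)²)` (`M_h ≥ 1`; the spare factor
`(L·M_h)⁻¹` of print's `M^{−1}` is given away). [cite: Balaban1984PropagatorsII, p.247 («|Δh_□| ≤ O(1)M^{−1}(L^jη)^{−2}»), (2.94) p.239, bookkeeping] -/
theorem c0C_value_le (hR2 : 2 * (ℓ + 1) ^ 2 ≤ R) (cf : ℝ) {y : ↥(B6Geom246MultiLevelBoxL0.bset D.toDomains)} (hy : y ∈ QT D hMh1 hP4 c) :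
    sc hMh1 hP4 c cf * (((d : ℝ) + 1) * (((((ℓ + 1 : ℕ) : ℝ)) ^ j0 hMh1 hP4 c) ^ 2 * (C2F d ℓ / (8 / 5 * (bigSide ℓ Mh c.1.1 : ℝ)) ^ 2)))
      ≤ ((d : ℝ) + 1) * C2F d ℓ * ((ℓ : ℝ) + 1) * cf ^ 2 / ((geomTB D).M * (geomTB D).len y ^ 2) := by
  have hR : 2 * (ℓ + 1) ≤ R := le_trans (by nlinarith : 2 * (ℓ + 1) ≤ 2 * (ℓ + 1) ^ 2) hR2
  have hjy := level_le_of_mem_QT hMh1 hP4 c hR hy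
  have hC2 := C2F_nonneg d ℓ
  have hM1 : (1 : ℝ) ≤ Mh := by exact_mod_cast hMh1
  have hMpos : (0 : ℝ) < Mh := by linarith
  have hM0 : (Mh : ℝ) ≠ 0 := hMpos.ne'
  have hL1 : (1 : ℝ) ≤ (ℓ : ℝ) + 1 := by linarith [(Nat.cast_nonneg ℓ : (0 : ℝ) ≤ ℓ)]
  have hLpos : (0 : ℝ) < (ℓ : ℝ) + 1 := by linarith
  have hL0 : (ℓ : ℝ) + 1 ≠ 0 := hLpos.ne'
  have e1 : sc hMh1 hP4 c cf * (((d : ℝ) + 1) * (((((ℓ + 1 : ℕ) : ℝ)) ^ j0 hMh1 hP4 c) ^ 2 * (C2F d ℓ / (8 / 5 * (bigSide ℓ Mh c.1.1 : ℝ)) ^ 2)))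
      = cf ^ 2 * (((d : ℝ) + 1) * C2F d ℓ) * 25 / (64 * (Mh : ℝ) ^ 2 * ((ℓ : ℝ) + 1) ^ (2 * c.1.1 + 2)) := by
    unfold sc bigSide
    push_cast
    field_simp
    ring
  have e2 : ((d : ℝ) + 1) * C2F d ℓ * ((ℓ : ℝ) + 1) * cf ^ 2 / ((geomTB D).M * (geomTB D).len y ^ 2)
      = cf ^ 2 * (((d : ℝ) + 1) * C2F d ℓ) / ((Mh : ℝ) * ((ℓ : ℝ) + 1) ^ (2 * y.1.1)) := by
    rw [geomTB_M, geomTB_len]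
    field_simp
    ring
  rw [e1, e2, div_le_div_iff₀ (by positivity) (by positivity)]
  have hpow : ((ℓ : ℝ) + 1) ^ (2 * y.1.1) ≤ ((ℓ : ℝ) + 1) ^ (2 * c.1.1 + 2) := pow_le_pow_right₀ hL1 (by omega)
  have hmono : 25 * ((Mh : ℝ) * ((ℓ : ℝ) + 1) ^ (2 * y.1.1)) ≤ 64 * (Mh : ℝ) ^ 2 * ((ℓ : ℝ) + 1) ^ (2 * c.1.1 + 2) := by
    have h0 : 0 ≤ ((ℓ : ℝ) + 1) ^ (2 * c.1.1 + 2) := by positivity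
    have h1 : (Mh : ℝ) ≤ (Mh : ℝ) ^ 2 := by nlinarith
    nlinarith [mul_le_mul_of_nonneg_left hpow hMpos.le, mul_le_mul_of_nonneg_right h1 h0]
  calc cf ^ 2 * (((d : ℝ) + 1) * C2F d ℓ) * 25 * ((Mh : ℝ) * ((ℓ : ℝ) + 1) ^ (2 * y.1.1))
      = cf ^ 2 * (((d : ℝ) + 1) * C2F d ℓ) * (25 * ((Mh : ℝ) * ((ℓ : ℝ) + 1) ^ (2 * y.1.1))) := by ring
    _ ≤ cf ^ 2 * (((d : ℝ) + 1) * C2F d ℓ) * (64 * (Mh : ℝ) ^ 2 * ((ℓ : ℝ) + 1) ^ (2 * c.1.1 + 2)) :=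
        mul_le_mul_of_nonneg_left hmono (by positivity)

/-- **`hcf` FOR THE CUBE — THE SIZE OF `c_e`**: `|c_e(x)| ≤ s₁·c′²/(M·len(y(x))²)` with `s₁ := C1F·L³` (on `d, L` only), for every bond `x` of the
global torus (`M = L·M_h` of `geomTB D`, `len(y) = L^{j(y)}`) — print's *"|∂h_□| ≤ O(1)(ML^jη)^{−1}"* times the unit `s(□)·L^{j₀}` of the rescaled
`E_e = L^{j₀}(S − 1)`. [cite: Balaban1984PropagatorsII, p.247 («|∂h_□| ≤ O(1)(ML^jη)^{−1}»), (2.92) p.239 (line 1), (2.94) p.239, (2.134) p.247] -/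
theorem abs_cfC_le (hM8 : 8 ≤ Mh) (hMhL : 2 * (ℓ + 1) ≤ Mh) (hR2 : 2 * (ℓ + 1) ^ 2 ≤ R) (hP5 : ∀ μ, 5 ≤ P' μ) (hpl : Placed ℓ k P' c.1)
    (w : BondIdx (B6GlobalChartV1L0.domT hN D hk) → ℝ) (cf : ℝ) (e : Fin (d + 1) × Bool) (x : PBond (PV d ℓ m K hd hL) 0) :
    |cfC hN hk hMh1 hP4 hMha c ha hpl w cf e x| ≤ C1F d ℓ * ((ℓ : ℝ) + 1) ^ 3 * cf ^ 2 / ((geomTB D).M * (geomTB D).len (blkV1 hN D x) ^ 2) := by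
  by_cases hx : cfC hN hk hMh1 hP4 hMha c ha hpl w cf e x = 0
  · rw [hx, abs_zero, geomTB_M, geomTB_len]
    have hC1 := C1F_nonneg d ℓ
    have hMpos : (0 : ℝ) < Mh := by exact_mod_cast hMh1
    positivity
  have hy : blkV1 hN D x ∈ QT D hMh1 hP4 c := (mem_ST D hMh1 hP4 c _).1 (cfC_supp hN hk hMh1 hP4 hMha c ha hM8 hR2 hP5 hpl w cf e x hx)
  refine le_trans ?_ (cfC_value_le hMh1 hP4 c hL hR2 cf hy)
  unfold cfC
  rw [trV_apply]
  exact abs_cfC_chart_le hN hk hMh1 hP4 hMha c ha hM8 hMhL hR2 hP5 hpl w cf e _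

/-- **`hc₀` FOR THE CUBE — THE SIZE OF `c₀`**: `|c₀(x)| ≤ s₂·c′²/(M·len(y(x))²)` with `s₂ := (d+1)·C2F·L` (on `d, L` only) — print's
*"|Δh_□| ≤ O(1)M^{−1}(L^jη)^{−2}"* times the unit `s(□)·L^{2j₀}` of the rescaled `Δ_□`. [cite: Balaban1984PropagatorsII, p.247 («|Δh_□| ≤ O(1)M^{−1}(L^jη)^{−2}»), (2.92) p.239 (line 1), (2.94) p.239, (2.134) p.247] -/
theorem abs_c0C_le (hM8 : 8 ≤ Mh) (hR2 : 2 * (ℓ + 1) ^ 2 ≤ R) (hP5 : ∀ μ, 5 ≤ P' μ) (hpl : Placed ℓ k P' c.1)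
    (w : BondIdx (B6GlobalChartV1L0.domT hN D hk) → ℝ) (cf : ℝ) (x : PBond (PV d ℓ m K hd hL) 0) :
    |c0C hN hk hMh1 hP4 hMha c ha hpl w cf x| ≤
      ((d : ℝ) + 1) * C2F d ℓ * ((ℓ : ℝ) + 1) * cf ^ 2 / ((geomTB D).M * (geomTB D).len (blkV1 hN D x) ^ 2) := by
  by_cases hx : c0C hN hk hMh1 hP4 hMha c ha hpl w cf x = 0
  · rw [hx, abs_zero, geomTB_M, geomTB_len]
    have hC2 := C2F_nonneg d ℓ
    have hMpos : (0 : ℝ) < Mh := by exact_mod_cast hMh1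
    positivity
  have hy : blkV1 hN D x ∈ QT D hMh1 hP4 c := (mem_ST D hMh1 hP4 c _).1 (c0C_supp hN hk hMh1 hP4 hMha c ha hM8 hR2 hP5 hpl w cf x hx)
  refine le_trans ?_ (c0C_value_le hMh1 hP4 c hR2 cf hy)
  unfold c0C
  rw [trV_apply]
  exact abs_c0C_chart_le hN hk hMh1 hP4 hMha c ha hM8 hR2 hP5 hpl w cf _

end Coeff

end Literature.MathematicalPhysics.QuantumFieldTheory.Balaban1983to89.B6CubeCoeffSizesV1L0
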